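import Summits.KontsevichZagierPeriods.KontsevichZagierPeriods.Theorems.LinRedNormalFormArrangementNormalFormStubRebaseSimplePosManyBasic

/-!
# Stub `stub_rebaseSimplePosMany`, part `rebaseSimplePosMany_product` (crux `ArrangementNormalForm`, line `janus-bands`) — `Moves`

The elementary moves on product representations over a base of dimension `B + 1` with `K`
fibres (`RebaseMany.IsProd`) acting on ONE fibre `i`, the other fibres riding along as spectators
(the `B`-generic port of `RebaseZero`'s part `Moves`; none of them changes a base coordinate):
* `RebaseMany.pull1` — the affine pull-back `tᵢ = μ sᵢ + α y + δ(x')` of the single fibre `i`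
  (rule 2; `RebasePos.pull` with trivial data off `i`), its TERMINAL instance
  `RebaseMany.good_terminal` (a letter-free fibre, or a fibre one of whose bounds is parallel in
  `y` to its letter, is put in format by one pull-back), the reflection `tᵢ ↦ −tᵢ`
  (`RebaseMany.reflect`) and the shear of the letter to `0` (`RebaseMany.shear`);
* `RebaseMany.rowSplit` — cutting the base cell by the sign of an atom (rule 1a, `RebasePos.cutBase`);
* `RebaseMany.fibSplit` — cutting the fibre `i` at an affine level (rule 1a, `RebasePos.cutFibre`);
* `RebaseMany.IsProd.addRow` — recording the redundant row `Vᵢ − Uᵢ > 0`.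
Registered: `rebaseSimplePosMany_affF_pullC`.

References: M. Kontsevich, D. Zagier, *Periods* (2001), §1.2, rules (1), (2).
-/

noncomputable section

open Set MeasureTheory MvPolynomial
open Literature.NumberTheory.Transcendental Literature.ModelTheory.ExponentialFields

namespace Summit.KontsevichZagierPeriods.ArrangementNormalForm.JanusBands

namespace RebaseMany

open SeparatePos RebasePos

variable {B K : ℕ}

/-! ### Pulled-back atoms -/

/-- The pulled-back atom in closed form: `pullC μ α δ c = μ⁻¹ (c − (α y + δ))`. [folklore] -/
theorem pullC_eq (μ α : ℚ) (δ : (Fin B → ℚ) × ℚ) (c : Cf B) : pullC μ α δ c = μ⁻¹ • (c - glue α δ) := by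
  refine Prod.ext (funext fun j => ?_) ?_
  · simp [pullC, glue, div_eq_inv_mul]
  · simp [pullC, glue, div_eq_inv_mul]

/-- Value of a pulled-back atom. [folklore] -/
theorem affF_pullC (μ α : ℚ) (δ : (Fin B → ℚ) × ℚ) (c : Cf B) (z : Fin (B + 1 + K) → ℝ) :
    affF B K (pullC μ α δ c) z = (μ : ℝ)⁻¹ * (affF B K c z - affF B K (glue α δ) z) := by
  rw [pullC_eq, affF_smul, affF_sub, Rat.cast_inv]

/-- Value of an atom pulled back by a pure shear (`μ = 1`). [folklore] -/
theorem affF_pullC_one (α : ℚ) (δ : (Fin B → ℚ) × ℚ) (c : Cf B) (z : Fin (B + 1 + K) → ℝ) :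
    affF B K (pullC 1 α δ c) z = affF B K c z - affF B K (glue α δ) z := by
  rw [affF_pullC, Rat.cast_one, inv_one, one_mul]

/-- Value of an atom sheared along the atom `c`. [folklore] -/
theorem affF_pullC_shear (c u : Cf B) (z : Fin (B + 1 + K) → ℝ) :
    affF B K (pullC 1 (c.1 (Fin.last B)) (restr B c) u) z = affF B K u z - affF B K c z := by
  rw [affF_pullC_one, glue_restr]

/-- The `y`-slope of an atom sheared along `c`. [folklore] -/
theorem pullC_shear_fst_last (c u : Cf B) :
    (pullC 1 (c.1 (Fin.last B)) (restr B c) u).1 (Fin.last B) = u.1 (Fin.last B) - c.1 (Fin.last B) := by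
  rw [pullC_fst_last, div_one]

/-! ### The single-fibre pull-back -/

/-- **The single-fibre affine pull-back** `tᵢ = μ sᵢ + α y + δ(x')` (rule 2): the letter and
the bounds of the fibre `i` are pulled back by `RebasePos.pullC` (bounds swapped if `μ < 0`), the
spectator fibres are untouched, the numerator picks up the constant `RebasePos.pullQ`. -/
theorem pull1 {s : KZ.IntegralRep (B + 1 + K)} {m' : ℕ} {M : Fin m' → Cf B} {U V : Fin K → Cf B}
    {T : BData B} {p : MvPolynomial (Fin B) ℚ} {a : Fin K → Option (Cf B)} (h : IsProd s M U V T p a)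
    (i : Fin K) (μ α : ℚ) (δ : (Fin B → ℚ) × ℚ) (hμ : μ ≠ 0) :
    ∃ s' : KZ.IntegralRep (B + 1 + K),
      IsProd s' M (Function.update U i (if 0 < μ then pullC μ α δ (U i) else pullC μ α δ (V i)))
        (Function.update V i (if 0 < μ then pullC μ α δ (V i) else pullC μ α δ (U i))) T
        (C (pullQ (pullMu i μ) a) * p) (Function.update a i ((a i).map (pullC μ α δ))) ∧
      (∀ w, w ∈ s'.domain ↔ pullInv (pullMu i μ) (pullAl i α) (pullDe i δ) w ∈ s.domain) ∧
      KZ.of s - KZ.of s' ∈ KZ.relations := by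
  obtain ⟨s', hmem, -, hdom', hint', hrel⟩ := pull (pullMu i μ) (pullAl i α) (pullDe i δ) s M T.L
    T.e p T.ℓ₁ T.ℓ₂ T.n₁ T.n₂ a (fun j => Sum.inr (U j)) (fun j => Sum.inr (V j)) h.bdd h.dom h.int
    (pullMu_ne_zero i hμ) (fun i j hij => by rcases hij with h | h <;> cases h)
  have hi := pullData_self i μ α δ
  have hlo : pullLo (pullMu i μ) (pullAl i α) (pullDe i δ) (fun j => Sum.inr (U j)) (fun j => Sum.inr (V j)) =
      fun j => Sum.inr (Function.update U i
        (if 0 < μ then pullC μ α δ (U i) else pullC μ α δ (V i)) j) := by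
    funext j
    by_cases hji : j = i
    · subst hji
      simp only [pullLo, hi.1, hi.2.1, hi.2.2, Function.update_self]
      split_ifs <;> rfl
    · obtain ⟨h1, h2, h3⟩ := pullData_of_ne i μ α δ hji
      simp only [pullLo, h1, h2, h3, zero_lt_one, if_true, Sum.map_inr, pullC_one_zero, id,
        Function.update_of_ne hji]
  have hhi : pullHi (pullMu i μ) (pullAl i α) (pullDe i δ) (fun j => Sum.inr (U j)) (fun j => Sum.inr (V j)) =
      fun j => Sum.inr (Function.update V i
        (if 0 < μ then pullC μ α δ (V i) else pullC μ α δ (U i)) j) := by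
    funext j
    by_cases hji : j = i
    · subst hji
      simp only [pullHi, hi.1, hi.2.1, hi.2.2, Function.update_self]
      split_ifs <;> rfl
    · obtain ⟨h1, h2, h3⟩ := pullData_of_ne i μ α δ hji
      simp only [pullHi, h1, h2, h3, zero_lt_one, if_true, Sum.map_inr, pullC_one_zero, id,
        Function.update_of_ne hji]
  have ha : pullA (pullMu i μ) (pullAl i α) (pullDe i δ) a = Function.update a i ((a i).map (pullC μ α δ)) := by
    funext j
    by_cases hji : j = i
    · subst hji
      simp only [pullA, hi.1, hi.2.1, hi.2.2, Function.update_self]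
    · obtain ⟨h1, h2, h3⟩ := pullData_of_ne i μ α δ hji
      simp only [pullA, h1, h2, h3, pullC_one_zero, Option.map_id, id, Function.update_of_ne hji]
  refine ⟨s', ⟨?_, ?_, h.adm, h.cbd⟩, hmem, hrel⟩
  · rw [hdom', hlo, hhi]; rfl
  · rw [← ha]; exact hint'

/-- **Terminal move.** If the fibre `i` is letter-free, or one of its bounds is parallel in `y`
to its letter, ONE single-fibre pull-back puts it in format (shear along the letter, rescale the
other bound to the coordinate `y` itself: the product recipe `RebasePos.prodμ/prodα/prodδ` at `i`),
the spectators untouched; so the representation is good as soon as the continuation hypothesis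
holds over sub-cells of the base cell. -/
theorem good_terminal {s : KZ.IntegralRep (B + 1 + K)} {m' : ℕ} {M : Fin m' → Cf B}
    {U V : Fin K → Cf B} {T : BData B} {p : MvPolynomial (Fin B) ℚ} {a : Fin K → Option (Cf B)}
    (h : IsProd s M U V T p a) (i : Fin K) (hP : HPc T i M U V a)
    (hs : ∀ c, a i = some c →
      (U i).1 (Fin.last B) = c.1 (Fin.last B) ∨ (V i).1 (Fin.last B) = c.1 (Fin.last B)) :
    Good B K (KZ.of s) := by
  have hs' : (U i).1 (Fin.last B) - prodα a U i = 0 ∨ (V i).1 (Fin.last B) - prodα a U i = 0 := by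
    rcases ha : a i with _ | c
    · exact Or.inl (by simp [prodα, ha])
    · rcases hs c ha with h' | h'
      · exact Or.inl (by simp only [prodα, ha, Option.elim_some, h', sub_self])
      · exact Or.inr (by simp only [prodα, ha, Option.elim_some, h', sub_self])
  obtain ⟨s', h', -, hrel⟩ := pull1 h i (prodμ a U V i) (prodα a U i) (prodδ a U V i)
    (prodμ_ne_zero a U V i)
  refine good_of_sub_mem hrel (hP.apply h' Subset.rfl ⟨fun c hc => ?_, ?_⟩ (same_update i U V a _ _ _))
  · simp only [Function.update_self] at hc
    rcases ha : a i with _ | c₀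
    · simp [ha] at hc
    · rw [ha, Option.map_some, Option.some.injEq] at hc
      rw [← hc, pullC_fst_last]
      simp [prodα, ha]
  · obtain ⟨hu, hv⟩ := prod_bounds a U V i hs'
    simp only [Function.update_self]
    split_ifs
    · exact ⟨hu, hv⟩
    · exact ⟨hv, hu⟩

/-- The reflection pull-back is negation on atoms. [folklore] -/
theorem pullC_neg_one : pullC (B := B) (-1) 0 0 = Neg.neg := funext pullC_reflect

/-- **Reflection `tᵢ ↦ −tᵢ`** of the fibre `i` (rule 2). -/
theorem reflect {s : KZ.IntegralRep (B + 1 + K)} {m' : ℕ} {M : Fin m' → Cf B} {U V : Fin K → Cf B}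
    {T : BData B} {p : MvPolynomial (Fin B) ℚ} {a : Fin K → Option (Cf B)} (h : IsProd s M U V T p a)
    (i : Fin K) : ∃ s' : KZ.IntegralRep (B + 1 + K),
      IsProd s' M (Function.update U i (-V i)) (Function.update V i (-U i)) T
        (C (pullQ (pullMu i (-1)) a) * p) (Function.update a i ((a i).map Neg.neg)) ∧
      KZ.of s - KZ.of s' ∈ KZ.relations := by
  obtain ⟨s', h', -, hrel⟩ := pull1 h i (-1) 0 0 (by norm_num)
  refine ⟨s', ?_, hrel⟩
  simp only [show ¬ (0 : ℚ) < -1 by norm_num, if_false, pullC_neg_one] at h'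
  exact h'

/-- **Shearing the letter of the fibre `i` to `0`** (rule 2, `μ = 1`, `α` the letter's `y`-slope,
`δ` its `x'`-part): the bounds become `Uᵢ − c`, `Vᵢ − c`. -/
theorem shear {s : KZ.IntegralRep (B + 1 + K)} {m' : ℕ} {M : Fin m' → Cf B} {U V : Fin K → Cf B}
    {T : BData B} {p : MvPolynomial (Fin B) ℚ} {a : Fin K → Option (Cf B)} (h : IsProd s M U V T p a)
    (i : Fin K) (c : Cf B) (ha : a i = some c) : ∃ s' : KZ.IntegralRep (B + 1 + K),
      IsProd s' M (Function.update U i (pullC 1 (c.1 (Fin.last B)) (restr B c) (U i)))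
        (Function.update V i (pullC 1 (c.1 (Fin.last B)) (restr B c) (V i))) T
        (C (pullQ (pullMu i 1) a) * p) (Function.update a i (some 0)) ∧
      KZ.of s - KZ.of s' ∈ KZ.relations := by
  obtain ⟨s', h', -, hrel⟩ := pull1 h i 1 (c.1 (Fin.last B)) (restr B c) one_ne_zero
  refine ⟨s', ?_, hrel⟩
  rw [ha] at h'
  simp only [zero_lt_one, if_true, Option.map_some, pullC_self] at h'
  exact h'

/-! ### Cuts -/

/-- **Cutting the base cell by the sign of a non-zero atom** (rule 1a, null wall). -/
theorem rowSplit {s : KZ.IntegralRep (B + 1 + K)} {m' : ℕ} {M : Fin m' → Cf B} {U V : Fin K → Cf B}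
    {T : BData B} {p : MvPolynomial (Fin B) ℚ} {a : Fin K → Option (Cf B)} (h : IsProd s M U V T p a)
    (q : Cf B) (hq : q ≠ 0)
    (h₁ : ∀ s₁ : KZ.IntegralRep (B + 1 + K), IsProd s₁ (Fin.snoc M q : Fin (m' + 1) → Cf B) U V T p a →
      Good B K (KZ.of s₁))
    (h₂ : ∀ s₂ : KZ.IntegralRep (B + 1 + K), IsProd s₂ (Fin.snoc M (-q) : Fin (m' + 1) → Cf B) U V T p a →
      Good B K (KZ.of s₂)) : Good B K (KZ.of s) := by
  obtain ⟨s₁, s₂, hm₁, hm₂, hi₁, hi₂, hd₁, hd₂, hrel⟩ :=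
    cutBase s M (fun j => Sum.inr (U j)) (fun j => Sum.inr (V j)) h.dom q hq
  obtain ⟨R, hR⟩ := h.cbd
  refine good_of_rel3 hrel
    (h₁ s₁ ⟨hd₁, fun z hz => ?_, h.adm, R, fun z hz => hR z (cell_snoc_subset M q hz)⟩)
    (h₂ s₂ ⟨hd₂, fun z hz => ?_, h.adm, R, fun z hz => hR z (cell_snoc_subset M (-q) hz)⟩)
  · rw [hi₁]; exact h.int ((hm₁ z).1 hz).1
  · rw [hi₂]; exact h.int ((hm₂ z).1 hz).1

/-- **Cutting the fibre `i` at an affine level `θ`** with `Uᵢ ≤ θ ≤ Vᵢ` on the base cell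
(rule 1a, null level set): if both pieces are good, so is the representation. -/
theorem fibSplit {s : KZ.IntegralRep (B + 1 + K)} {m' : ℕ} {M : Fin m' → Cf B} {U V : Fin K → Cf B}
    {T : BData B} {p : MvPolynomial (Fin B) ℚ} {a : Fin K → Option (Cf B)} (h : IsProd s M U V T p a)
    (i : Fin K) (θ : Cf B)
    (hθ : ∀ z ∈ cell K M, affF B K (U i) z ≤ affF B K θ z ∧ affF B K θ z ≤ affF B K (V i) z)
    (h₁ : ∀ s₁ : KZ.IntegralRep (B + 1 + K), IsProd s₁ M U (Function.update V i θ) T p a →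
      Good B K (KZ.of s₁))
    (h₂ : ∀ s₂ : KZ.IntegralRep (B + 1 + K), IsProd s₂ M (Function.update U i θ) V T p a →
      Good B K (KZ.of s₂)) : Good B K (KZ.of s) := by
  obtain ⟨s₁, s₂, hd₁, hd₂, hi₁, hi₂, hsub₁, hsub₂, hrel⟩ := cutFibre s M (fun j => Sum.inr (U j))
    (fun j => Sum.inr (V j)) h.dom i θ (fun z hz => (hθ z hz.1).2) (fun z hz => (hθ z hz.1).1)
  obtain ⟨R, hR⟩ := h.cbd
  rw [update_inr] at hd₁ hd₂
  exact good_of_rel3 hrel (h₁ s₁ ⟨hd₁, fun z hz => by rw [hi₁]; exact h.int (hsub₁ hz), h.adm, R, hR⟩)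
    (h₂ s₂ ⟨hd₂, fun z hz => by rw [hi₂]; exact h.int (hsub₂ hz), h.adm, R, hR⟩)

/-- Recording the redundant row `Vᵢ − Uᵢ > 0`. [folklore] -/
theorem IsProd.addRow {s : KZ.IntegralRep (B + 1 + K)} {m' : ℕ} {M : Fin m' → Cf B} {U V : Fin K → Cf B}
    {T : BData B} {p : MvPolynomial (Fin B) ℚ} {a : Fin K → Option (Cf B)} (h : IsProd s M U V T p a)
    (i : Fin K) : IsProd s (Fin.snoc M (V i - U i) : Fin (m' + 1) → Cf B) U V T p a := by
  obtain ⟨R, hR⟩ := h.cbd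
  refine ⟨?_, h.int, h.adm, R, fun z hz => hR z (cell_snoc_subset M _ hz)⟩
  rw [h.dom]
  ext z
  rw [mem_pDom, mem_pDom, mem_cell_snoc, affF_sub, sub_pos]
  constructor
  · rintro ⟨hy, hf⟩; exact ⟨⟨hy, (hf i).1.trans (hf i).2⟩, hf⟩
  · rintro ⟨⟨hy, -⟩, hf⟩; exact ⟨hy, hf⟩

/-- **Crossing letter level**: a lettered fibre `i` admitting a level `θ` parallel in `y` to its
letter between its bounds on the base cell is good (cut at `θ`, both pieces terminal). -/
theorem good_levelCut {s : KZ.IntegralRep (B + 1 + K)} {m' : ℕ} {M : Fin m' → Cf B}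
    {U V : Fin K → Cf B} {T : BData B} {p : MvPolynomial (Fin B) ℚ} {a : Fin K → Option (Cf B)}
    (h : IsProd s M U V T p a) (i : Fin K) (hP : HPc T i M U V a) (θ : Cf B)
    (hθc : ∀ c, a i = some c → θ.1 (Fin.last B) = c.1 (Fin.last B))
    (hθ : ∀ z ∈ cell K M, affF B K (U i) z ≤ affF B K θ z ∧ affF B K θ z ≤ affF B K (V i) z) :
    Good B K (KZ.of s) := by
  refine fibSplit h i θ hθ (fun s₁ h₁ => ?_) (fun s₂ h₂ => ?_)
  · refine good_terminal h₁ i (hP.transfer fun j hj => ⟨rfl, rfl, Function.update_of_ne hj _ _⟩)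
      fun c hc => Or.inr ?_
    rw [Function.update_self]
    exact hθc c hc
  · refine good_terminal h₂ i (hP.transfer fun j hj => ⟨rfl, Function.update_of_ne hj _ _, rfl⟩)
      fun c hc => Or.inl ?_
    rw [Function.update_self]
    exact hθc c hc

end RebaseMany

/-- Registered support goal of this file: the value of a pulled-back atom of the literal text,
`(pullC μ α δ c)(x', y) = μ⁻¹ (c(x', y) − α y − δ(x'))`. -/
theorem rebaseSimplePosMany_affF_pullC (B K : ℕ) (μ α : ℚ) (δ : (Fin B → ℚ) × ℚ) (c : (Fin (B + 1) → ℚ) × ℚ) (z : Fin (B + 1 + K) → ℝ) : SeparatePos.affF B K (RebasePos.pullC μ α δ c) z = (μ : ℝ)⁻¹ * (SeparatePos.affF B K c z - SeparatePos.affF B K (RebaseMany.glue α δ) z) :=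
  RebaseMany.affF_pullC μ α δ c z

end Summit.KontsevichZagierPeriods.ArrangementNormalForm.JanusBands
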